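import Summits.CriticalPhenomena.Ising3DConformalLimit.Theses.LocalisationClock
import HarnessLib

/-!
# Crux `LocalisationClock.ImryMaWindowNoise` (stmt-CriticalPhenomena-15883) — birth skeleton (BC3)

Skeleton-register seat `planner-skel-stmt-CriticalPhenomena-15883-0`, 2026-08-17 (route
`route-CriticalPhenomena-LocalisationClock`, rank-3 crux, re-audit bin REPAIRABLE; no `Disproof.lean`,
no earlier workfile on this crux: `ledger crux ls stmt-CriticalPhenomena-15883` was empty).

## §0 The crux

Critical `+` state of `ℤ³` at `β_c(3)`, marginal `w_L` on the box `Λ_L = box 3 L`, observed through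
the planted Gaussian channel `y = s τ* + √s Z` on the whole box (stochastic localisation at SNR `s`);
posterior `∝ w_L(τ) e^{⟨y,τ⟩}`, block spin `M = Σ_x τ_x`, posterior polarisation `m(y) = E_y M`,
clock rate `r(y) = Σ_x Cov_y(τ_x, M)²`, planted expectation `P_{L,s}`, `σ_L² = ⟨M_L²⟩⁺_{β_c}`.
CRUX (`ImryMaWindowNoise`): there are `0 < a < b < 1`, `c > 0` such that for all large `L` and every
`s ≥ 0` on the interquantile window `a σ_L² ≤ P_{L,s}[m²] ≤ b σ_L²` of the clock,
`P[r m²] − P[r] P[m²] ≤ −c · P[r] · P[m²]` (order-one anti-correlation of the posterior block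
stiffness with the squared posterior polarisation).

## §1 The line: TIME SANDWICH OF THE WINDOW AT THE IMRY–MA SCALE + AHARONY–HARRIS AT FIXED RESCALED TIME

The route's own two-layer plan for this node ("ImryMaWindowNoise ⇐ RFIM dictionary (envelopes
locating the window) → window anti-concentration at one scale") typed as three registered stubs,
all over the crux's verbatim `let` functionals (`w, tilt, m, Af, r, P, σ2`), with the Imry–Ma time
written parameter-free and division-free as the product `s · σ_L²` measured against `|Λ_L|`
(`t*_L = |Λ_L| / σ_L² ≍ L^{-(2-η)}`):

* `stub_noEarlyWindow` — THE CLOCK IS NOT EARLY (upper envelope of the clock + block two-point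
  doubling). For every level `a ∈ (0,1)` there are `κ₁ > 0`, `L₀` with: `a σ_L² ≤ P_{L,s}[m²]` forces
  `κ₁ |Λ_L| ≤ s σ_L²`. Mechanism: `P_s[m²] = ∫₀ˢ P_u[r] du` (clock identity, `m*(β_c(3)) = 0` so
  `P_0[m²] = 0`), the PATHWISE domination `0 ≤ Cov_y(τ_x,τ_v) ≤ ⟨σ_xσ_v⟩⁺_{β_c}` for every signed
  field `y` (FKG + Ding–Song–Sun 2022 Cor. 1.3 on the approximating `+` boxes, free = plus at
  `β_c(3)`), hence `r(y) ≤ r(0) = ‖G𝟙‖²` and `P_s[m²] ≤ s ‖G𝟙‖²`; and the block doubling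
  `‖G𝟙‖² = Σ_x (Σ_v ⟨σ_xσ_v⟩)² ≤ C σ_L⁴ / |Λ_L|` (Messager–Miracle-Solé monotonicity gives
  `χ_{2ℓ} ≤ C χ_ℓ` for the box partial sums of the critical two-point function). Size L; the inputs
  are named facts in tree (`DingSongSun2022_signedFieldDomination`, `messager_miracleSole`,
  `spontaneousMagnetization_criticalBeta_eq_zero`-type, `hasBoxLimit_isingCorr_plus`) plus the
  Gaussian-channel calculus of the support item `ClockIdentity` (stmt-CriticalPhenomena-15885).
* `stub_noLateWindow` — THE CLOCK IS NOT LATE (Riccati saturation). For every `b ∈ (0,1)` there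
  are `κ₂ > 0`, `L₀` with: `P_{L,s}[m²] ≤ b σ_L²` forces `s σ_L² ≤ κ₂ |Λ_L|`. Mechanism: with
  `u(s) = σ_L² − P_s[m²] = P_s[Var_y(M)] ≥ 0`, Cauchy–Schwarz over the `|Λ_L|` sites gives
  `r(y) ≥ Var_y(M)² / |Λ_L|`, Jensen gives `u' = −P_s[r] ≤ −u²/|Λ_L|`, so `u(s) ≤ |Λ_L| / s` and
  `κ₂ = 1/(1−b)` works for every `L`. Size M (provable as soon as the clock calculus of
  `ClockIdentity` is in Lean); no `ℤ³` input beyond `w_L` being a probability weight.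
* `stub_imryMaAnticoncentration` — AHARONY–HARRIS AT EVERY FIXED MULTIPLE OF THE IMRY–MA TIME (the
  open heart, the only `ℤ³`-specific statement of the line). For all `κ₁, κ₂ > 0` there are
  `c > 0`, `L₀` such that for `L ≥ L₀` and every `s ≥ 0` with `κ₁ |Λ_L| ≤ s σ_L² ≤ κ₂ |Λ_L|`:
  `P[r m²] − P[r]P[m²] ≤ −c P[r] P[m²]`. At `s = κ t*_L` the planted random-field problem sits at
  its crossover `ξ_RF(s) ≍ L` for EVERY fixed `κ` (`y_RF = 1 − η/2 > 0`), so the planted block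
  susceptibility `r` should not self-average and, by the sign of `LocalisationGHS`, be order-one
  anti-correlated with `m²`; for `κ → 0` the ratio is the hyperscaling-normalised Lebowitz
  coefficient `2 s |U₄(G𝟙,𝟙,G𝟙,G𝟙)| / ‖G𝟙‖⁴ ≍ κ`, for `κ → ∞` self-averaging returns — hence
  constants depending on `(κ₁, κ₂)`, never uniform. Why it might fail: as the crux (CLT over many
  weakly dependent sub-blocks at the window would give `c_L → 0`, as happens in `d ≥ 4`).
  Size: open-problem.

Neither stub is the crux or the summit: stubs 1–2 say nothing about the covariance, stub 3 is
conditioned on the TIME window (no cheap passage to the `m²`-window without BOTH envelopes, and no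
passage back at all: the envelopes are one-sided), and none mentions scaling limits. BC3 probes
(`stub → ImryMaWindowNoise`, `stub → Ising3DConformalLimit`, `stub → ¬Ising3DConformalLimit` by
`first | exact? | simpa using h | simpa [C] using h | (unfold C; simpa using h) | aesop`) all FAIL —
table in `Lines/birth.md`. Disproof used: none exists for this crux. Negatives index
(`ledger negatives --problem CriticalPhenomena`, 11 entries): nothing on this sub-problem, nothing on
planted / random fields or block-spin clocks.

## §2 The composition `ImryMaWindowNoise_of` (kernel-checked, no `sorry`)

Take `a = 1/3`, `b = 2/3`; `κ₁` from stub 1 at `a`, `κ₂` from stub 2 at `b`, then `(c, L₃)` from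
stub 3 at `(κ₁, κ₂)`; `L₀ = max L₁ (max L₂ L₃)`. For `L ≥ L₀`, `s ≥ 0` on the `m²`-window the two
envelopes place `s σ_L²` in `[κ₁ |Λ_L|, κ₂ |Λ_L|]` and stub 3 gives the inequality verbatim.
Hypotheses = the three stub statements BY NAME (`Sig.stub_*`, definitionally the registered
signatures: `ImryMaWindowNoise_of_stubs` feeds the registered stubs and type-checks the match).
The file replicates the route file's `open` lines so that the crux's inline functionals and the
stubs' copies elaborate to the same terms (same `Decidable` instances in `w`).

References: A. Aharony, A. B. Harris, PRL 77 (1996) 3700 (absence of self-averaging at random fixed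
points, `y_RF = 1 − η/2`); J. Ding, J. Song, R. Sun, PTRF 186 (2023) 477 = arXiv:2107.09243, Cor. 1.3
(`⟨σ_u;σ_v⟩_g ≤ ⟨σ_uσ_v⟩_0` for every signed field `g`) and Remark 1.4; A. Messager,
S. Miracle-Solé, J. Stat. Phys. 17 (1977) 245 (monotonicity of correlations); M. Aizenman,
H. Duminil-Copin, V. Sidoravicius, CMP 334 (2015) Thm 1.2 (`m*(β_c) = 0`, free = plus at `β_c`);
R. Bauerschmidt, T. Bodineau, B. Dagallier, Probab. Surv. 21 (2024) = arXiv:2307.07619 §4.5, §6.3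
(stochastic localisation = Polchinski flow for Ising); S. Friedli, Y. Velenik (CUP 2017) §3.4, §3.6.
-/

noncomputable section

namespace Summit.CriticalPhenomena.Ising3DConformalLimit.Cruxes.ImryMaWindowNoise.Birth

-- same `open` context as the route file `Theses/LocalisationClock.lean` (identical elaboration of the inline functionals)
open scoped BigOperators Topology Manifold Classical MeasureTheory ProbabilityTheory Matrix InnerProductSpace ComplexConjugate ContinuousMap
open Filter Set Function TopologicalSpace MeasureTheory

/-! ## §1 The stub statements as named propositions (verbatim copies of the stub signatures) -/

namespace Sig

/-- Statement of `stub_noEarlyWindow` (the clock is not early: level `a` of the clock is reached no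
sooner than `s σ_L² ≥ κ₁ |Λ_L|`). [folklore] -/
def stub_noEarlyWindow : Prop :=
    let βc : ℝ := Literature.Probability.LatticeModels.criticalBeta 3;
    let w : (L : ℕ) → (↥(Literature.Probability.LatticeModels.box 3 L) → ℤˣ) → ℝ := fun L τ =>
        Literature.Probability.LatticeModels.plusExpect 3 βc 0 (fun σ => if (∀ x :
        ↥(Literature.Probability.LatticeModels.box 3 L), σ x = τ x) then 1 else 0);
    let tilt : (L : ℕ) → (↥(Literature.Probability.LatticeModels.box 3 L) → ℝ) →
        ((↥(Literature.Probability.LatticeModels.box 3 L) → ℤˣ) → ℝ) → ℝ := fun L y g => (∑ τ, w L τ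
        * g τ * Real.exp (∑ x, y x * ((τ x : ℤ) : ℝ))) / (∑ τ, w L τ * Real.exp (∑ x, y x * ((τ x :
        ℤ) : ℝ)));
    let m : (L : ℕ) → (↥(Literature.Probability.LatticeModels.box 3 L) → ℝ) → ℝ := fun L y => tilt L
        y (fun τ => ∑ x, ((τ x : ℤ) : ℝ));
    let P : (L : ℕ) → ℝ → ((↥(Literature.Probability.LatticeModels.box 3 L) → ℝ) → ℝ) → ℝ := fun L s
        Φ => ∑ τ, w L τ * ∫ z, Φ (fun x => s * ((τ x : ℤ) : ℝ) + Real.sqrt s * z x)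
        ∂(MeasureTheory.Measure.pi fun _ : ↥(Literature.Probability.LatticeModels.box 3 L) =>
        ProbabilityTheory.gaussianReal 0 1);
    let σ2 : ℕ → ℝ := fun L => Literature.Probability.LatticeModels.plusExpect 3 βc 0 (fun σ => (∑ x
        ∈ Literature.Probability.LatticeModels.box 3 L, Literature.Probability.LatticeModels.spinAt
        x σ) ^ 2);
    ∀ a : ℝ, 0 < a → a < 1 → ∃ κ₁ : ℝ, 0 < κ₁ ∧ ∃ L₀ : ℕ, ∀ L ≥ L₀, ∀ s : ℝ, 0 ≤ s → a * σ2 L ≤ P L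
        s (fun y => m L y ^ 2) → κ₁ * ((Literature.Probability.LatticeModels.box 3 L).card : ℝ) ≤ s
        * σ2 L

/-- Statement of `stub_noLateWindow` (the clock is not late: below level `b` one has
`s σ_L² ≤ κ₂ |Λ_L|`). [folklore] -/
def stub_noLateWindow : Prop :=
    let βc : ℝ := Literature.Probability.LatticeModels.criticalBeta 3;
    let w : (L : ℕ) → (↥(Literature.Probability.LatticeModels.box 3 L) → ℤˣ) → ℝ := fun L τ =>
        Literature.Probability.LatticeModels.plusExpect 3 βc 0 (fun σ => if (∀ x :
        ↥(Literature.Probability.LatticeModels.box 3 L), σ x = τ x) then 1 else 0);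
    let tilt : (L : ℕ) → (↥(Literature.Probability.LatticeModels.box 3 L) → ℝ) →
        ((↥(Literature.Probability.LatticeModels.box 3 L) → ℤˣ) → ℝ) → ℝ := fun L y g => (∑ τ, w L τ
        * g τ * Real.exp (∑ x, y x * ((τ x : ℤ) : ℝ))) / (∑ τ, w L τ * Real.exp (∑ x, y x * ((τ x :
        ℤ) : ℝ)));
    let m : (L : ℕ) → (↥(Literature.Probability.LatticeModels.box 3 L) → ℝ) → ℝ := fun L y => tilt L
        y (fun τ => ∑ x, ((τ x : ℤ) : ℝ));
    let P : (L : ℕ) → ℝ → ((↥(Literature.Probability.LatticeModels.box 3 L) → ℝ) → ℝ) → ℝ := fun L s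
        Φ => ∑ τ, w L τ * ∫ z, Φ (fun x => s * ((τ x : ℤ) : ℝ) + Real.sqrt s * z x)
        ∂(MeasureTheory.Measure.pi fun _ : ↥(Literature.Probability.LatticeModels.box 3 L) =>
        ProbabilityTheory.gaussianReal 0 1);
    let σ2 : ℕ → ℝ := fun L => Literature.Probability.LatticeModels.plusExpect 3 βc 0 (fun σ => (∑ x
        ∈ Literature.Probability.LatticeModels.box 3 L, Literature.Probability.LatticeModels.spinAt
        x σ) ^ 2);
    ∀ b : ℝ, 0 < b → b < 1 → ∃ κ₂ : ℝ, 0 < κ₂ ∧ ∃ L₀ : ℕ, ∀ L ≥ L₀, ∀ s : ℝ, 0 ≤ s → P L s (fun y =>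
        m L y ^ 2) ≤ b * σ2 L → s * σ2 L ≤ κ₂ * ((Literature.Probability.LatticeModels.box 3 L).card
        : ℝ)

/-- Statement of `stub_imryMaAnticoncentration` (Aharony–Harris anti-concentration of the critical
clock at every fixed multiple of the Imry–Ma time). [cite: AharonyHarris1996, abstract: no self-averaging when the randomness is relevant] -/
def stub_imryMaAnticoncentration : Prop :=
    let βc : ℝ := Literature.Probability.LatticeModels.criticalBeta 3;
    let w : (L : ℕ) → (↥(Literature.Probability.LatticeModels.box 3 L) → ℤˣ) → ℝ := fun L τ =>
        Literature.Probability.LatticeModels.plusExpect 3 βc 0 (fun σ => if (∀ x :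
        ↥(Literature.Probability.LatticeModels.box 3 L), σ x = τ x) then 1 else 0);
    let tilt : (L : ℕ) → (↥(Literature.Probability.LatticeModels.box 3 L) → ℝ) →
        ((↥(Literature.Probability.LatticeModels.box 3 L) → ℤˣ) → ℝ) → ℝ := fun L y g => (∑ τ, w L τ
        * g τ * Real.exp (∑ x, y x * ((τ x : ℤ) : ℝ))) / (∑ τ, w L τ * Real.exp (∑ x, y x * ((τ x :
        ℤ) : ℝ)));
    let m : (L : ℕ) → (↥(Literature.Probability.LatticeModels.box 3 L) → ℝ) → ℝ := fun L y => tilt L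
        y (fun τ => ∑ x, ((τ x : ℤ) : ℝ));
    let Af : (L : ℕ) → (↥(Literature.Probability.LatticeModels.box 3 L) → ℝ) →
        ↥(Literature.Probability.LatticeModels.box 3 L) → ℝ := fun L y x => tilt L y (fun τ => ((τ x
        : ℤ) : ℝ) * ∑ x', ((τ x' : ℤ) : ℝ)) - tilt L y (fun τ => ((τ x : ℤ) : ℝ)) * m L y;
    let r : (L : ℕ) → (↥(Literature.Probability.LatticeModels.box 3 L) → ℝ) → ℝ := fun L y => ∑ x,
        Af L y x ^ 2;
    let P : (L : ℕ) → ℝ → ((↥(Literature.Probability.LatticeModels.box 3 L) → ℝ) → ℝ) → ℝ := fun L s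
        Φ => ∑ τ, w L τ * ∫ z, Φ (fun x => s * ((τ x : ℤ) : ℝ) + Real.sqrt s * z x)
        ∂(MeasureTheory.Measure.pi fun _ : ↥(Literature.Probability.LatticeModels.box 3 L) =>
        ProbabilityTheory.gaussianReal 0 1);
    let σ2 : ℕ → ℝ := fun L => Literature.Probability.LatticeModels.plusExpect 3 βc 0 (fun σ => (∑ x
        ∈ Literature.Probability.LatticeModels.box 3 L, Literature.Probability.LatticeModels.spinAt
        x σ) ^ 2);
    ∀ κ₁ κ₂ : ℝ, 0 < κ₁ → 0 < κ₂ → ∃ c : ℝ, 0 < c ∧ ∃ L₀ : ℕ, ∀ L ≥ L₀, ∀ s : ℝ, 0 ≤ s → κ₁ *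
        ((Literature.Probability.LatticeModels.box 3 L).card : ℝ) ≤ s * σ2 L → s * σ2 L ≤ κ₂ *
        ((Literature.Probability.LatticeModels.box 3 L).card : ℝ) → P L s (fun y => r L y * m L y ^
        2) - P L s (r L) * P L s (fun y => m L y ^ 2) ≤ -(c * (P L s (r L) * P L s (fun y => m L y ^
        2)))

end Sig

/-! ## §2 The registered stubs (the only `sorry`s of this file) -/

/-- **stub_noEarlyWindow** (THE CLOCK IS NOT EARLY). For the marginal `w_L` of the critical `+`
state of `ℤ³` on `box 3 L` localised through the Gaussian channel on the box (`tilt`, `m`, `P`,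
`σ2` verbatim as in the crux): for every `a ∈ (0,1)` there are `κ₁ > 0` and `L₀` such that for
`L ≥ L₀`, `s ≥ 0`, `a σ_L² ≤ P_{L,s}[m²]` implies `κ₁ |Λ_L| ≤ s σ_L²`. Upper envelope of the clock
`P_s[m²] = ∫₀ˢ P_u[r] ≤ s ‖G𝟙‖²` (clock identity; pathwise `0 ≤ Cov_y(τ_x,τ_v) ≤ ⟨σ_xσ_v⟩⁺_{β_c}`
by FKG and Ding–Song–Sun Cor. 1.3 on the approximating `+` boxes, free = plus at `β_c(3)`;
`P_0[m²] = 0` as `m*(β_c(3)) = 0`) and block doubling `‖G𝟙‖² ≤ C σ_L⁴/|Λ_L|`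
(Messager–Miracle-Solé). Size L. [cite: DingSongSun2022, Corollary 1.3 and Remark 1.4] -/
theorem stub_noEarlyWindow :
    let βc : ℝ := Literature.Probability.LatticeModels.criticalBeta 3;
    let w : (L : ℕ) → (↥(Literature.Probability.LatticeModels.box 3 L) → ℤˣ) → ℝ := fun L τ =>
        Literature.Probability.LatticeModels.plusExpect 3 βc 0 (fun σ => if (∀ x :
        ↥(Literature.Probability.LatticeModels.box 3 L), σ x = τ x) then 1 else 0);
    let tilt : (L : ℕ) → (↥(Literature.Probability.LatticeModels.box 3 L) → ℝ) →
        ((↥(Literature.Probability.LatticeModels.box 3 L) → ℤˣ) → ℝ) → ℝ := fun L y g => (∑ τ, w L τ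
        * g τ * Real.exp (∑ x, y x * ((τ x : ℤ) : ℝ))) / (∑ τ, w L τ * Real.exp (∑ x, y x * ((τ x :
        ℤ) : ℝ)));
    let m : (L : ℕ) → (↥(Literature.Probability.LatticeModels.box 3 L) → ℝ) → ℝ := fun L y => tilt L
        y (fun τ => ∑ x, ((τ x : ℤ) : ℝ));
    let P : (L : ℕ) → ℝ → ((↥(Literature.Probability.LatticeModels.box 3 L) → ℝ) → ℝ) → ℝ := fun L s
        Φ => ∑ τ, w L τ * ∫ z, Φ (fun x => s * ((τ x : ℤ) : ℝ) + Real.sqrt s * z x)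
        ∂(MeasureTheory.Measure.pi fun _ : ↥(Literature.Probability.LatticeModels.box 3 L) =>
        ProbabilityTheory.gaussianReal 0 1);
    let σ2 : ℕ → ℝ := fun L => Literature.Probability.LatticeModels.plusExpect 3 βc 0 (fun σ => (∑ x
        ∈ Literature.Probability.LatticeModels.box 3 L, Literature.Probability.LatticeModels.spinAt
        x σ) ^ 2);
    ∀ a : ℝ, 0 < a → a < 1 → ∃ κ₁ : ℝ, 0 < κ₁ ∧ ∃ L₀ : ℕ, ∀ L ≥ L₀, ∀ s : ℝ, 0 ≤ s → a * σ2 L ≤ P L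
        s (fun y => m L y ^ 2) → κ₁ * ((Literature.Probability.LatticeModels.box 3 L).card : ℝ) ≤ s
        * σ2 L := by
  sorry

/-- **stub_noLateWindow** (THE CLOCK IS NOT LATE). Same objects: for every `b ∈ (0,1)` there are
`κ₂ > 0` and `L₀` such that for `L ≥ L₀`, `s ≥ 0`, `P_{L,s}[m²] ≤ b σ_L²` implies
`s σ_L² ≤ κ₂ |Λ_L|`. Riccati saturation: `u(s) = σ_L² − P_s[m²] = P_s[Var_y M] ≥ 0`,
`r(y) ≥ Var_y(M)²/|Λ_L|` (Cauchy–Schwarz over sites), `u' = −P_s[r] ≤ −u²/|Λ_L|` (Jensen), hence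
`u(s) ≤ |Λ_L|/s` and `κ₂ = 1/(1−b)`. Size M (Gaussian-channel calculus of `ClockIdentity`). [folklore] -/
theorem stub_noLateWindow :
    let βc : ℝ := Literature.Probability.LatticeModels.criticalBeta 3;
    let w : (L : ℕ) → (↥(Literature.Probability.LatticeModels.box 3 L) → ℤˣ) → ℝ := fun L τ =>
        Literature.Probability.LatticeModels.plusExpect 3 βc 0 (fun σ => if (∀ x :
        ↥(Literature.Probability.LatticeModels.box 3 L), σ x = τ x) then 1 else 0);
    let tilt : (L : ℕ) → (↥(Literature.Probability.LatticeModels.box 3 L) → ℝ) →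
        ((↥(Literature.Probability.LatticeModels.box 3 L) → ℤˣ) → ℝ) → ℝ := fun L y g => (∑ τ, w L τ
        * g τ * Real.exp (∑ x, y x * ((τ x : ℤ) : ℝ))) / (∑ τ, w L τ * Real.exp (∑ x, y x * ((τ x :
        ℤ) : ℝ)));
    let m : (L : ℕ) → (↥(Literature.Probability.LatticeModels.box 3 L) → ℝ) → ℝ := fun L y => tilt L
        y (fun τ => ∑ x, ((τ x : ℤ) : ℝ));
    let P : (L : ℕ) → ℝ → ((↥(Literature.Probability.LatticeModels.box 3 L) → ℝ) → ℝ) → ℝ := fun L s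
        Φ => ∑ τ, w L τ * ∫ z, Φ (fun x => s * ((τ x : ℤ) : ℝ) + Real.sqrt s * z x)
        ∂(MeasureTheory.Measure.pi fun _ : ↥(Literature.Probability.LatticeModels.box 3 L) =>
        ProbabilityTheory.gaussianReal 0 1);
    let σ2 : ℕ → ℝ := fun L => Literature.Probability.LatticeModels.plusExpect 3 βc 0 (fun σ => (∑ x
        ∈ Literature.Probability.LatticeModels.box 3 L, Literature.Probability.LatticeModels.spinAt
        x σ) ^ 2);
    ∀ b : ℝ, 0 < b → b < 1 → ∃ κ₂ : ℝ, 0 < κ₂ ∧ ∃ L₀ : ℕ, ∀ L ≥ L₀, ∀ s : ℝ, 0 ≤ s → P L s (fun y =>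
        m L y ^ 2) ≤ b * σ2 L → s * σ2 L ≤ κ₂ * ((Literature.Probability.LatticeModels.box 3 L).card
        : ℝ) := by
  sorry

/-- **stub_imryMaAnticoncentration** (AHARONY–HARRIS AT THE IMRY–MA SCALE — the open heart). Same
objects plus the clock rate `r` (verbatim `Af`, `r` of the crux): for all `κ₁, κ₂ > 0` there are
`c > 0` and `L₀` such that for `L ≥ L₀` and every `s ≥ 0` with `κ₁ |Λ_L| ≤ s σ_L² ≤ κ₂ |Λ_L|`
(every fixed multiple of the Imry–Ma time `t*_L = |Λ_L|/σ_L²`, where `ξ_RF(s) ≍ L`):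
`P[r m²] − P[r] P[m²] ≤ −c P[r] P[m²]`. Non-self-averaging of the planted block susceptibility at a
random-field-relevant critical point (`y_RF = 1 − η/2 > 0`), anti-correlated with the squared
polarisation; constants depend on `(κ₁, κ₂)`. Open (ℤ³-specific; false in `d ≥ 4` read through
the clock identity). [cite: AharonyHarris1996, abstract: no self-averaging when the randomness is relevant] -/
theorem stub_imryMaAnticoncentration :
    let βc : ℝ := Literature.Probability.LatticeModels.criticalBeta 3;
    let w : (L : ℕ) → (↥(Literature.Probability.LatticeModels.box 3 L) → ℤˣ) → ℝ := fun L τ =>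
        Literature.Probability.LatticeModels.plusExpect 3 βc 0 (fun σ => if (∀ x :
        ↥(Literature.Probability.LatticeModels.box 3 L), σ x = τ x) then 1 else 0);
    let tilt : (L : ℕ) → (↥(Literature.Probability.LatticeModels.box 3 L) → ℝ) →
        ((↥(Literature.Probability.LatticeModels.box 3 L) → ℤˣ) → ℝ) → ℝ := fun L y g => (∑ τ, w L τ
        * g τ * Real.exp (∑ x, y x * ((τ x : ℤ) : ℝ))) / (∑ τ, w L τ * Real.exp (∑ x, y x * ((τ x :
        ℤ) : ℝ)));
    let m : (L : ℕ) → (↥(Literature.Probability.LatticeModels.box 3 L) → ℝ) → ℝ := fun L y => tilt L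
        y (fun τ => ∑ x, ((τ x : ℤ) : ℝ));
    let Af : (L : ℕ) → (↥(Literature.Probability.LatticeModels.box 3 L) → ℝ) →
        ↥(Literature.Probability.LatticeModels.box 3 L) → ℝ := fun L y x => tilt L y (fun τ => ((τ x
        : ℤ) : ℝ) * ∑ x', ((τ x' : ℤ) : ℝ)) - tilt L y (fun τ => ((τ x : ℤ) : ℝ)) * m L y;
    let r : (L : ℕ) → (↥(Literature.Probability.LatticeModels.box 3 L) → ℝ) → ℝ := fun L y => ∑ x,
        Af L y x ^ 2;
    let P : (L : ℕ) → ℝ → ((↥(Literature.Probability.LatticeModels.box 3 L) → ℝ) → ℝ) → ℝ := fun L s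
        Φ => ∑ τ, w L τ * ∫ z, Φ (fun x => s * ((τ x : ℤ) : ℝ) + Real.sqrt s * z x)
        ∂(MeasureTheory.Measure.pi fun _ : ↥(Literature.Probability.LatticeModels.box 3 L) =>
        ProbabilityTheory.gaussianReal 0 1);
    let σ2 : ℕ → ℝ := fun L => Literature.Probability.LatticeModels.plusExpect 3 βc 0 (fun σ => (∑ x
        ∈ Literature.Probability.LatticeModels.box 3 L, Literature.Probability.LatticeModels.spinAt
        x σ) ^ 2);
    ∀ κ₁ κ₂ : ℝ, 0 < κ₁ → 0 < κ₂ → ∃ c : ℝ, 0 < c ∧ ∃ L₀ : ℕ, ∀ L ≥ L₀, ∀ s : ℝ, 0 ≤ s → κ₁ *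
        ((Literature.Probability.LatticeModels.box 3 L).card : ℝ) ≤ s * σ2 L → s * σ2 L ≤ κ₂ *
        ((Literature.Probability.LatticeModels.box 3 L).card : ℝ) → P L s (fun y => r L y * m L y ^
        2) - P L s (r L) * P L s (fun y => m L y ^ 2) ≤ -(c * (P L s (r L) * P L s (fun y => m L y ^
        2))) := by
  sorry

/-! ## §3 The composition (no `sorry`) -/

/-- **The line closes the crux.** Levels `a = 1/3`, `b = 2/3`; the two one-sided envelopes put the
interquantile window inside the time window `κ₁ |Λ_L| ≤ s σ_L² ≤ κ₂ |Λ_L|`, on which stub 3 is the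
inequality. Hypotheses = the three stub statements BY NAME (`Sig.stub_*`). [folklore] -/
theorem ImryMaWindowNoise_of :
    Sig.stub_noEarlyWindow → Sig.stub_noLateWindow → Sig.stub_imryMaAnticoncentration →
      Summit.CriticalPhenomena.Ising3DConformalLimit.Theses.LocalisationClock.ImryMaWindowNoise := by
  intro h1 h2 h3
  obtain ⟨κ₁, hκ₁, L₁, H1⟩ := h1 (1 / 3) (by norm_num) (by norm_num)
  obtain ⟨κ₂, hκ₂, L₂, H2⟩ := h2 (2 / 3) (by norm_num) (by norm_num)
  obtain ⟨c, hc, L₃, H3⟩ := h3 κ₁ κ₂ hκ₁ hκ₂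
  unfold Summit.CriticalPhenomena.Ising3DConformalLimit.Theses.LocalisationClock.ImryMaWindowNoise
  intro βc w tilt m Af r P σ2
  refine ⟨1 / 3, 2 / 3, c, by norm_num, by norm_num, by norm_num, hc, max L₁ (max L₂ L₃), ?_⟩
  intro L hL s hs ha hb
  have hL₁ : L₁ ≤ L := le_trans (le_max_left _ _) hL
  have hL₂ : L₂ ≤ L := le_trans ((le_max_left _ _).trans (le_max_right _ _)) hL
  have hL₃ : L₃ ≤ L := le_trans ((le_max_right _ _).trans (le_max_right _ _)) hL
  exact H3 L hL₃ s hs (H1 L hL₁ s hs ha) (H2 L hL₂ s hs hb)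

/-- **The registered stubs discharge the three hypotheses of `ImryMaWindowNoise_of` verbatim** (no
`sorry` of its own; depends on the stubs' `sorry`s until they land — then it IS the proof of the
crux; it also kernel-checks that each `Sig.stub_X` is definitionally the registered signature of
`stub_X`). [folklore] -/
theorem ImryMaWindowNoise_of_stubs : Summit.CriticalPhenomena.Ising3DConformalLimit.Theses.LocalisationClock.ImryMaWindowNoise :=
  ImryMaWindowNoise_of stub_noEarlyWindow stub_noLateWindow stub_imryMaAnticoncentration

end Summit.CriticalPhenomena.Ising3DConformalLimit.Cruxes.ImryMaWindowNoise.Birth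

end
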